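import Summits.QuantumFields.YangMills.Theorems.BalabanUVNodesPortU8TwoVolumeRowC
import Summits.QuantumFields.YangMills.Theorems.BalabanUVNodesPortU8SkeletonV10
import Summits.QuantumFields.YangMills.Theses.BalabanUVNodes

/-!
# PORT PT-B (U8), g3 file 15 — ★★★ THE SKELETON AGAINST 27931 v11-G₄ «(ρ-tok)» (`bca3cb0d9af367ce` · 15 736 ch, SIGNED by CRIT-1 2026-08-31T04:06Z, sixth and LAST text;
# director-ym №496∕№498): the signed text, VERBATIM and UNCONDITIONALLY — the global two-volume row (R4ᴰ) of ✓`portPieceLocalityU8_v10_of` is now PROVED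
# (`rowR4D_L_sandwich`, g3 file 14) from the text's three DISPLAYED tokens ‴ (four (190)-clauses on `recordHr`, both members), Tok-182 (`recordHr = recordHrLocξ univ`)
# and Tok-cmpU-cap (window comparison at the sandwich radii), through the WINDOW TRANSPORT identity (g3 files 3–10); rows (R1ᴰ)(R3)(R5), (C2a)(C2b) as in g2 file 7

Cell `ym-nodeO-ideate` ∕ `ym-balaban-port`, porter `ymgap-nodeO-port-PTB-1` (gen 3), item **stmt-QuantumFields-27931** `BalabanUVNodes.PortPieceLocalityU8`.
Filed `--supports stmt-QuantumFields-27931` until the port-lead re-keys the slot to v11-G₄ (then re-filed as the closer).  [I] = [Balaban1987RG1], [15] = [Balaban1985Variational].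

WHAT THIS FILE PROVES (two theorems; no `def ∕ instance ∕ notation ∕ sorry`; standard axioms): `fourClauses_weaken` (monotonicity of the four (190)-clauses in the constant and
the exponential weight) and ★★★ `portPieceLocalityU8_v13 : <v11-G₄ verbatim>`.  PROOF = the proof of g2 file 7 with its hypothesis `hR4` REPLACED by the proved row: the two
token constants `(C₉', δ₉)` of ‴ and of Tok-cmpU-cap are unified to `C := max (max C‴ C_cmp) 1`, `δ := min δ‴ δ_cmp` (clause monotonicity), and `rowR4D_L_sandwich` is
instantiated at the member pair `(K₀+n, K₀+n+1)`, giving (R4ᴰ) with `δ₄ = δ∕4`, `C₄ = 2C·e^{δ(2Mc+2)}·2(3+2‖π_ℝ‖)e^{(δ∕2)Mc}∕α₂`.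
HONEST FRAMING.  v11-G₄ is an implication whose antecedent DISPLAYS Bałaban's variational∕gauge packages and the three (182)∕(190)-tokens as HYPOTHESES; this file proves the
implication — nothing of Bałaban's analysis is asserted, ported or discharged here; K0⁷ OPEN; NODE O 0∕1; COUNT 8∕28 · K 1∕4 UNMOVED; finite `𝕋⁴_{L^K}` at fixed ε — NOT
continuum ∕ OS ∕ Clay; **the Yang–Mills mass gap (Clay) is NOT proved.**
-/

noncomputable section

open scoped BigOperators Matrix.Norms.L2Operator

namespace Summit.QuantumFields.YangMills.Theorems.PortU8

open Literature.MathematicalPhysics.QuantumFieldTheory.Balaban1983to89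
open Literature.MathematicalPhysics.QuantumFieldTheory.Balaban1983to89.Node00
open Literature.MathematicalPhysics.QuantumFieldTheory.Balaban1983to89.T4Continuum (T4Family)
open Summit.QuantumFields.YangMills.Theorems.K0RecordFormatNames

/-- Monotonicity of the four (190)-clauses `‖H b‖ ≤ Cη e, ‖∂H‖ ≤ Cη²e, ‖ΔH‖ ≤ Cη³e, ‖d*dH‖ ≤ Cη³e` in the constant `C ≤ C'` (`C' ≥ 0`) and the weight `e ≤ e'` (`e ≥ 0`).
[cite: Balaban1985Variational, (190) p.308 (bookkeeping)] -/
theorem fourClauses_weaken (F : T4Family) {K' k : ℕ} (H : PBond (F.P K') 0 → Fin 2 → Fin 2 → ℂ) (b : PBond (F.P K') 0) {C C' e e' : ℝ}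
    (hC : C ≤ C') (hC' : 0 ≤ C') (he : e ≤ e') (he0 : 0 ≤ e)
    (h : ‖H b‖ ≤ C * (F.P K').eta (k + 1) * e ∧
      (∀ ν : Fin (F.P K').d, ‖H ⟨b.src.shift ν, b.dir⟩ - H b‖ ≤ C * (F.P K').eta (k + 1) ^ 2 * e) ∧
      ‖∑ ν : Fin (F.P K').d, (H ⟨b.src.shift ν, b.dir⟩ - (2 : ℂ) • H b + H ⟨b.src.unshift ν, b.dir⟩)‖ ≤ C * (F.P K').eta (k + 1) ^ 3 * e ∧
      ‖∑ ν : Fin (F.P K').d, ((H ⟨b.src, b.dir⟩ + H ⟨(b.src).shift b.dir, ν⟩ - H ⟨(b.src).shift ν, b.dir⟩ - H ⟨b.src, ν⟩) -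
        (H ⟨b.src.unshift ν, b.dir⟩ + H ⟨(b.src.unshift ν).shift b.dir, ν⟩ - H ⟨(b.src.unshift ν).shift ν, b.dir⟩ - H ⟨b.src.unshift ν, ν⟩))‖ ≤ C * (F.P K').eta (k + 1) ^ 3 * e) :
    ‖H b‖ ≤ C' * (F.P K').eta (k + 1) * e' ∧
      (∀ ν : Fin (F.P K').d, ‖H ⟨b.src.shift ν, b.dir⟩ - H b‖ ≤ C' * (F.P K').eta (k + 1) ^ 2 * e') ∧
      ‖∑ ν : Fin (F.P K').d, (H ⟨b.src.shift ν, b.dir⟩ - (2 : ℂ) • H b + H ⟨b.src.unshift ν, b.dir⟩)‖ ≤ C' * (F.P K').eta (k + 1) ^ 3 * e' ∧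
      ‖∑ ν : Fin (F.P K').d, ((H ⟨b.src, b.dir⟩ + H ⟨(b.src).shift b.dir, ν⟩ - H ⟨(b.src).shift ν, b.dir⟩ - H ⟨b.src, ν⟩) -
        (H ⟨b.src.unshift ν, b.dir⟩ + H ⟨(b.src.unshift ν).shift b.dir, ν⟩ - H ⟨(b.src.unshift ν).shift ν, b.dir⟩ - H ⟨b.src.unshift ν, ν⟩))‖ ≤ C' * (F.P K').eta (k + 1) ^ 3 * e' := by
  have hη : 0 ≤ (F.P K').eta (k + 1) := by unfold Params.eta; exact (pow_pos (inv_pos.2 (F.P K').cast_L_pos) _).le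
  have w : ∀ {u x : ℝ}, 0 ≤ x → u ≤ C * x * e → u ≤ C' * x * e' := fun hx hu =>
    hu.trans ((mul_le_mul_of_nonneg_right (mul_le_mul_of_nonneg_right hC hx) he0).trans (mul_le_mul_of_nonneg_left he (mul_nonneg hC' hx)))
  exact ⟨w hη h.1, fun ν => w (pow_nonneg hη 2) (h.2.1 ν), w (pow_nonneg hη 3) h.2.2.1, w (pow_nonneg hη 3) h.2.2.2⟩

/-- ★★★ **27931 v11-G₄ «(ρ-tok)» (`bca3cb0d9af367ce`, SIGNED 2026-08-31T04:06Z), VERBATIM, UNCONDITIONAL.**  Proof: unify the token constants, obtain the global two-volume row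
(R4ᴰ) from `rowR4D_L_sandwich` (‴ ⊕ Tok-182 ⊕ Tok-cmpU-cap ⊕ window transport), then the assembly of g2 file 7 (rows (R1ᴰ)(R3)(R5) from ‴ by `rowR1D_L_at` and
`response9D_fromL_of_decayRows`; (C2a) from TokP9reg by `contDiffAt_recordEmbJ_of_tokP9reg`; (C2b) by `recordEmbJ_zero_thetaFill`).
[cite: Balaban1987RG1, Thm 1 p.257, (1.21) p.264, (4.4)–(4.5) pp.281–282, (4.35) p.290; Balaban1985Variational, (21) p.281, (182) p.307, (190) p.308, Prop. 9 p.309] -/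
theorem portPieceLocalityU8_v13 :
    ∀ (F : Literature.MathematicalPhysics.QuantumFieldTheory.Balaban1983to89.T4Continuum.T4Family) (Mc : ℕ) (j c c₀ c₁ : ℕ) (B₃ B₃' a₀ a₁ : ℝ), Summit.QuantumFields.YangMills.Theorems.K0RecordFormatNames.McGuard F Mc → c ≤ F.L ^ j → c₀ ≤ j + 1 → c₁ ≤ j → 2 * (F.L : ℝ) ^ 2 ≤ B₃ → 0 < B₃' → 0 < a₀ → 0 < a₁ → Literature.MathematicalPhysics.QuantumFieldTheory.Balaban1983to89.Node00.VariationalThm1RegSepCoP7MGB F 2 (fun ν M g K k _s => c ≤ ν.M₁ ∧ k + c₀ ≤ F.m + K ∧ F.L ^ c₁ ∣ M ∧ ∀ i, 1 ≤ i → i ≤ k → Literature.MathematicalPhysics.QuantumFieldTheory.Balaban1983to89.Node00.dCubeSide (F.P K).L M (Literature.MathematicalPhysics.QuantumFieldTheory.Balaban1983to89.Node00.RkOfRecord (F.P K).L ν.r (g i)) i ∣ (F.P K).sitesPerDir 0) (Literature.MathematicalPhysics.QuantumFieldTheory.Balaban1983to89.Node00.lamDatum F) (Literature.MathematicalPhysics.QuantumFieldTheory.Balaban1983to89.Node00.dataSmall7LamTopOf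 F 2) B₃ a₀ a₁ → Literature.MathematicalPhysics.QuantumFieldTheory.Balaban1983to89.Node00.Gauge9RegSepTopStepGB F 2 (fun ν K Ω => Literature.MathematicalPhysics.QuantumFieldTheory.Balaban1983to89.Node00.suppDomOfRecord F ν K Ω) (F.L ^ j) (fun ν M g K k _s => c ≤ ν.M₁ ∧ k + c₀ ≤ F.m + K ∧ F.L ^ c₁ ∣ M ∧ ∀ i, 1 ≤ i → i ≤ k → Literature.MathematicalPhysics.QuantumFieldTheory.Balaban1983to89.Node00.dCubeSide (F.P K).L M (Literature.MathematicalPhysics.QuantumFieldTheory.Balaban1983to89.Node00.RkOfRecord (F.P K).L ν.r (g i)) i ∣ (F.P K).sitesPerDir 0) (Literature.MathematicalPhysics.QuantumFieldTheory.Balaban1983to89.Node00.lamDatum F) (Literature.MathematicalPhysics.QuantumFieldTheory.Balaban1983to89.Node00.dataSmall7LamTopOf F 2) B₃ B₃' a₀ a₁ → (∀ ε₁ : ℝ, 0 < ε₁ → ε₁ ≤ a₁ → B₃ * ε₁ ≤ a₀ → ∀ (k n : ℕ) (V : Literature.MathematicalPhysics.QuantumFieldTheory.Balaban1983to89.GaugeField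 (F.P (Summit.QuantumFields.YangMills.Theorems.K0RecordFormatNames.recordK₀ F Mc k + n)) (k + 1) (Literature.MathematicalPhysics.QuantumFieldTheory.Balaban1983to89.Node00.SU 2)), Literature.MathematicalPhysics.QuantumFieldTheory.Balaban1983to89.PlaqSmall ε₁ V → Literature.MathematicalPhysics.QuantumFieldTheory.Balaban1983to89.Node00.UkExists F 2 (Summit.QuantumFields.YangMills.Theorems.K0RecordFormatNames.recordK₀ F Mc k + n) (k + 1) a₀ V ∧ Literature.MathematicalPhysics.QuantumFieldTheory.Balaban1983to89.Node00.UniqueUkOrbit F 2 (Summit.QuantumFields.YangMills.Theorems.K0RecordFormatNames.recordK₀ F Mc k + n) (k + 1) a₀ V) → (∀ (k n : ℕ) (ε₂₉ : ℝ), 0 < ε₂₉ → letI θ := Summit.QuantumFields.YangMills.Theorems.K0RecordFormatNames.thetaFill F a₀ ε₂₉; letI := θ.instVβ₁; letI := θ.instVβ₂; letI := θ.instιβ; AnalyticAt ℝ (fun B : Summit.QuantumFields.YangMills.Theorems.K0RecordFormatNames.recordW F a₀ ε₂₉ k (Summit.QuantumFields.YangMills.Theorems.K0RecordFormatNames.recordK₀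 F Mc k + n) => fun (b : Literature.MathematicalPhysics.QuantumFieldTheory.Balaban1983to89.PBond (F.P (Summit.QuantumFields.YangMills.Theorems.K0RecordFormatNames.recordK₀ F Mc k + n)) 0) (i i' : Fin 2) => ((Summit.QuantumFields.YangMills.Theorems.K0RecordFormatNames.recordBgField F θ k (Summit.QuantumFields.YangMills.Theorems.K0RecordFormatNames.recordK₀ F Mc k + n) B b : Literature.MathematicalPhysics.QuantumFieldTheory.Balaban1983to89.Node00.SU 2) : Matrix (Fin 2) (Fin 2) ℂ) i i') 0) → ((∃ C₉' δ₉ : ℝ, 0 ≤ C₉' ∧ 0 < δ₉ ∧ ∀ (k n : ℕ) (ε₂₉ : ℝ), 0 < ε₂₉ → letI θ := Summit.QuantumFields.YangMills.Theorems.K0RecordFormatNames.thetaFill F a₀ ε₂₉; letI := θ.instVβ₁; letI := θ.instVβ₂; letI := θ.instιβ; ∀ (a : θ.ιβ) (μ : Fin (F.P (Summit.QuantumFields.YangMills.Theorems.K0RecordFormatNames.recordK₀ F Mc k + n)).d) (y : Literature.MathematicalPhysics.QuantumFieldTheory.Balaban1983to89.Site (F.P (Summit.QuantumFields.YangMills.Theorems.K0RecordFormatNames.recordK₀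 F Mc k + n)) (k + 1)), letI Hr : Literature.MathematicalPhysics.QuantumFieldTheory.Balaban1983to89.PBond (F.P (Summit.QuantumFields.YangMills.Theorems.K0RecordFormatNames.recordK₀ F Mc k + n)) 0 → Fin 2 → Fin 2 → ℂ := fun b' => Summit.QuantumFields.YangMills.Theorems.K0RecordFormatNames.recordHr F θ k (Summit.QuantumFields.YangMills.Theorems.K0RecordFormatNames.recordK₀ F Mc k + n) a (μ, y) b'; ∀ b : Literature.MathematicalPhysics.QuantumFieldTheory.Balaban1983to89.PBond (F.P (Summit.QuantumFields.YangMills.Theorems.K0RecordFormatNames.recordK₀ F Mc k + n)) 0, ‖Hr b‖ ≤ C₉' * (F.P (Summit.QuantumFields.YangMills.Theorems.K0RecordFormatNames.recordK₀ F Mc k + n)).eta (k + 1) * Real.exp (-(δ₉ * (Literature.MathematicalPhysics.QuantumFieldTheory.Balaban1983to89.Site.tdist (Summit.QuantumFields.YangMills.Theorems.K0RecordFormatNames.coarsenTo (k + 1) b.src) y : ℝ))) ∧ (∀ ν : Fin (F.P (Summit.QuantumFields.YangMills.Theorems.K0RecordFormatNames.recordK₀ F Mc k + n)).d, ‖Hr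 (⟨b.src.shift ν, b.dir⟩ : Literature.MathematicalPhysics.QuantumFieldTheory.Balaban1983to89.PBond (F.P (Summit.QuantumFields.YangMills.Theorems.K0RecordFormatNames.recordK₀ F Mc k + n)) 0) - Hr b‖ ≤ C₉' * (F.P (Summit.QuantumFields.YangMills.Theorems.K0RecordFormatNames.recordK₀ F Mc k + n)).eta (k + 1) ^ 2 * Real.exp (-(δ₉ * (Literature.MathematicalPhysics.QuantumFieldTheory.Balaban1983to89.Site.tdist (Summit.QuantumFields.YangMills.Theorems.K0RecordFormatNames.coarsenTo (k + 1) b.src) y : ℝ)))) ∧ ‖∑ ν : Fin (F.P (Summit.QuantumFields.YangMills.Theorems.K0RecordFormatNames.recordK₀ F Mc k + n)).d, (Hr (⟨b.src.shift ν, b.dir⟩ : Literature.MathematicalPhysics.QuantumFieldTheory.Balaban1983to89.PBond (F.P (Summit.QuantumFields.YangMills.Theorems.K0RecordFormatNames.recordK₀ F Mc k + n)) 0) - (2 : ℂ) • Hr b + Hr (⟨b.src.unshift ν, b.dir⟩ : Literature.MathematicalPhysics.QuantumFieldTheory.Balaban1983to89.PBond (F.P (Summit.QuantumFields.YangMills.Theorems.K0RecordFormatNames.recordK₀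 F Mc k + n)) 0))‖ ≤ C₉' * (F.P (Summit.QuantumFields.YangMills.Theorems.K0RecordFormatNames.recordK₀ F Mc k + n)).eta (k + 1) ^ 3 * Real.exp (-(δ₉ * (Literature.MathematicalPhysics.QuantumFieldTheory.Balaban1983to89.Site.tdist (Summit.QuantumFields.YangMills.Theorems.K0RecordFormatNames.coarsenTo (k + 1) b.src) y : ℝ))) ∧ ‖∑ ν : Fin (F.P (Summit.QuantumFields.YangMills.Theorems.K0RecordFormatNames.recordK₀ F Mc k + n)).d, ((Hr (⟨b.src, b.dir⟩ : Literature.MathematicalPhysics.QuantumFieldTheory.Balaban1983to89.PBond (F.P (Summit.QuantumFields.YangMills.Theorems.K0RecordFormatNames.recordK₀ F Mc k + n)) 0) + Hr (⟨(b.src).shift b.dir, ν⟩ : Literature.MathematicalPhysics.QuantumFieldTheory.Balaban1983to89.PBond (F.P (Summit.QuantumFields.YangMills.Theorems.K0RecordFormatNames.recordK₀ F Mc k + n)) 0) - Hr (⟨(b.src).shift ν, b.dir⟩ : Literature.MathematicalPhysics.QuantumFieldTheory.Balaban1983to89.PBond (F.P (Summit.QuantumFields.YangMills.Theorems.K0RecordFormatNames.recordK₀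 F Mc k + n)) 0) - Hr (⟨b.src, ν⟩ : Literature.MathematicalPhysics.QuantumFieldTheory.Balaban1983to89.PBond (F.P (Summit.QuantumFields.YangMills.Theorems.K0RecordFormatNames.recordK₀ F Mc k + n)) 0)) - (Hr (⟨b.src.unshift ν, b.dir⟩ : Literature.MathematicalPhysics.QuantumFieldTheory.Balaban1983to89.PBond (F.P (Summit.QuantumFields.YangMills.Theorems.K0RecordFormatNames.recordK₀ F Mc k + n)) 0) + Hr (⟨(b.src.unshift ν).shift b.dir, ν⟩ : Literature.MathematicalPhysics.QuantumFieldTheory.Balaban1983to89.PBond (F.P (Summit.QuantumFields.YangMills.Theorems.K0RecordFormatNames.recordK₀ F Mc k + n)) 0) - Hr (⟨(b.src.unshift ν).shift ν, b.dir⟩ : Literature.MathematicalPhysics.QuantumFieldTheory.Balaban1983to89.PBond (F.P (Summit.QuantumFields.YangMills.Theorems.K0RecordFormatNames.recordK₀ F Mc k + n)) 0) - Hr (⟨b.src.unshift ν, ν⟩ : Literature.MathematicalPhysics.QuantumFieldTheory.Balaban1983to89.PBond (F.P (Summit.QuantumFields.YangMills.Theorems.K0RecordFormatNames.recordK₀ F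 Mc k + n)) 0)))‖ ≤ C₉' * (F.P (Summit.QuantumFields.YangMills.Theorems.K0RecordFormatNames.recordK₀ F Mc k + n)).eta (k + 1) ^ 3 * Real.exp (-(δ₉ * (Literature.MathematicalPhysics.QuantumFieldTheory.Balaban1983to89.Site.tdist (Summit.QuantumFields.YangMills.Theorems.K0RecordFormatNames.coarsenTo (k + 1) b.src) y : ℝ)))) ∧ (∀ (k n : ℕ) (ε₂₉ : ℝ), 0 < ε₂₉ → letI θ := Summit.QuantumFields.YangMills.Theorems.K0RecordFormatNames.thetaFill F a₀ ε₂₉; letI := θ.instVβ₁; letI := θ.instVβ₂; letI := θ.instιβ; ∀ (a : θ.ιβ) (μ : Fin (F.P (Summit.QuantumFields.YangMills.Theorems.K0RecordFormatNames.recordK₀ F Mc k + n)).d) (y : Literature.MathematicalPhysics.QuantumFieldTheory.Balaban1983to89.Site (F.P (Summit.QuantumFields.YangMills.Theorems.K0RecordFormatNames.recordK₀ F Mc k + n)) (k + 1)), ∀ b : Literature.MathematicalPhysics.QuantumFieldTheory.Balaban1983to89.PBond (F.P (Summit.QuantumFields.YangMills.Theorems.K0RecordFormatNames.recordK₀ F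 Mc k + n)) 0, Summit.QuantumFields.YangMills.Theorems.K0RecordFormatNames.recordHr F θ k (Summit.QuantumFields.YangMills.Theorems.K0RecordFormatNames.recordK₀ F Mc k + n) a (μ, y) b = Summit.QuantumFields.YangMills.Theorems.K0RecordFormatNames.recordHrLocξ F θ k (Summit.QuantumFields.YangMills.Theorems.K0RecordFormatNames.recordK₀ F Mc k + n) Finset.univ a (μ, y) b) ∧ ((∃ C₉' δ₉ : ℝ, 0 ≤ C₉' ∧ 0 < δ₉ ∧ ∀ (k n : ℕ) (ε₂₉ : ℝ), 0 < ε₂₉ → letI θ := Summit.QuantumFields.YangMills.Theorems.K0RecordFormatNames.thetaFill F a₀ ε₂₉; letI := θ.instVβ₁; letI := θ.instVβ₂; letI := θ.instιβ; ∀ (a : θ.ιβ) (μ : Fin (F.P (Summit.QuantumFields.YangMills.Theorems.K0RecordFormatNames.recordK₀ F Mc k + n)).d) (y : Literature.MathematicalPhysics.QuantumFieldTheory.Balaban1983to89.Site (F.P (Summit.QuantumFields.YangMills.Theorems.K0RecordFormatNames.recordK₀ F Mc k + n)) (k + 1)), ∀ R3 R0 : ℕ, R3 + Summit.QuantumFields.YangMills.Theorems.K0RecordFormatNames.nestRadius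 Mc 1 ≤ R0 → 2 * (R0 + 1) < (F.P (Summit.QuantumFields.YangMills.Theorems.K0RecordFormatNames.recordK₀ F Mc k + n)).sitesPerDir (k + 1) → ∀ z₀ : Fin 4 → ℤ, y ∈ Summit.QuantumFields.YangMills.Theorems.K0RecordFormatNames.recordWindow F k (Summit.QuantumFields.YangMills.Theorems.K0RecordFormatNames.recordK₀ F Mc k + n) R3 z₀ → letI Hd : Literature.MathematicalPhysics.QuantumFieldTheory.Balaban1983to89.PBond (F.P (Summit.QuantumFields.YangMills.Theorems.K0RecordFormatNames.recordK₀ F Mc k + n)) 0 → Fin 2 → Fin 2 → ℂ := fun b' => Summit.QuantumFields.YangMills.Theorems.K0RecordFormatNames.recordHrLocξ F θ k (Summit.QuantumFields.YangMills.Theorems.K0RecordFormatNames.recordK₀ F Mc k + n) Finset.univ a (μ, y) b' - Summit.QuantumFields.YangMills.Theorems.K0RecordFormatNames.recordHrLocξ F θ k (Summit.QuantumFields.YangMills.Theorems.K0RecordFormatNames.recordK₀ F Mc k + n) (Summit.QuantumFields.YangMills.Theorems.K0RecordFormatNames.recordWindow F k (Summit.QuantumFields.YangMills.Theorems.K0RecordFormatNames.recordK₀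 F Mc k + n) R0 z₀) a (μ, y) b'; ∀ b : Literature.MathematicalPhysics.QuantumFieldTheory.Balaban1983to89.PBond (F.P (Summit.QuantumFields.YangMills.Theorems.K0RecordFormatNames.recordK₀ F Mc k + n)) 0, Summit.QuantumFields.YangMills.Theorems.K0RecordFormatNames.coarsenTo (k + 1) b.src ∈ Summit.QuantumFields.YangMills.Theorems.K0RecordFormatNames.recordWindow F k (Summit.QuantumFields.YangMills.Theorems.K0RecordFormatNames.recordK₀ F Mc k + n) R3 z₀ → ‖Hd b‖ ≤ C₉' * (F.P (Summit.QuantumFields.YangMills.Theorems.K0RecordFormatNames.recordK₀ F Mc k + n)).eta (k + 1) * Real.exp (-(δ₉ * ((R0 : ℝ) - (R3 : ℝ)))) ∧ (∀ ν : Fin (F.P (Summit.QuantumFields.YangMills.Theorems.K0RecordFormatNames.recordK₀ F Mc k + n)).d, ‖Hd (⟨b.src.shift ν, b.dir⟩ : Literature.MathematicalPhysics.QuantumFieldTheory.Balaban1983to89.PBond (F.P (Summit.QuantumFields.YangMills.Theorems.K0RecordFormatNames.recordK₀ F Mc k + n)) 0) - Hd b‖ ≤ C₉' * (F.P (Summit.QuantumFields.YangMills.Theorems.K0RecordFormatNames.recordK₀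 F Mc k + n)).eta (k + 1) ^ 2 * Real.exp (-(δ₉ * ((R0 : ℝ) - (R3 : ℝ))))) ∧ ‖∑ ν : Fin (F.P (Summit.QuantumFields.YangMills.Theorems.K0RecordFormatNames.recordK₀ F Mc k + n)).d, (Hd (⟨b.src.shift ν, b.dir⟩ : Literature.MathematicalPhysics.QuantumFieldTheory.Balaban1983to89.PBond (F.P (Summit.QuantumFields.YangMills.Theorems.K0RecordFormatNames.recordK₀ F Mc k + n)) 0) - (2 : ℂ) • Hd b + Hd (⟨b.src.unshift ν, b.dir⟩ : Literature.MathematicalPhysics.QuantumFieldTheory.Balaban1983to89.PBond (F.P (Summit.QuantumFields.YangMills.Theorems.K0RecordFormatNames.recordK₀ F Mc k + n)) 0))‖ ≤ C₉' * (F.P (Summit.QuantumFields.YangMills.Theorems.K0RecordFormatNames.recordK₀ F Mc k + n)).eta (k + 1) ^ 3 * Real.exp (-(δ₉ * ((R0 : ℝ) - (R3 : ℝ)))) ∧ ‖∑ ν : Fin (F.P (Summit.QuantumFields.YangMills.Theorems.K0RecordFormatNames.recordK₀ F Mc k + n)).d, ((Hd (⟨b.src, b.dir⟩ : Literature.MathematicalPhysics.QuantumFieldTheory.Balaban1983to89.PBond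 (F.P (Summit.QuantumFields.YangMills.Theorems.K0RecordFormatNames.recordK₀ F Mc k + n)) 0) + Hd (⟨(b.src).shift b.dir, ν⟩ : Literature.MathematicalPhysics.QuantumFieldTheory.Balaban1983to89.PBond (F.P (Summit.QuantumFields.YangMills.Theorems.K0RecordFormatNames.recordK₀ F Mc k + n)) 0) - Hd (⟨(b.src).shift ν, b.dir⟩ : Literature.MathematicalPhysics.QuantumFieldTheory.Balaban1983to89.PBond (F.P (Summit.QuantumFields.YangMills.Theorems.K0RecordFormatNames.recordK₀ F Mc k + n)) 0) - Hd (⟨b.src, ν⟩ : Literature.MathematicalPhysics.QuantumFieldTheory.Balaban1983to89.PBond (F.P (Summit.QuantumFields.YangMills.Theorems.K0RecordFormatNames.recordK₀ F Mc k + n)) 0)) - (Hd (⟨b.src.unshift ν, b.dir⟩ : Literature.MathematicalPhysics.QuantumFieldTheory.Balaban1983to89.PBond (F.P (Summit.QuantumFields.YangMills.Theorems.K0RecordFormatNames.recordK₀ F Mc k + n)) 0) + Hd (⟨(b.src.unshift ν).shift b.dir, ν⟩ : Literature.MathematicalPhysics.QuantumFieldTheory.Balaban1983to89.PBond (F.P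 (Summit.QuantumFields.YangMills.Theorems.K0RecordFormatNames.recordK₀ F Mc k + n)) 0) - Hd (⟨(b.src.unshift ν).shift ν, b.dir⟩ : Literature.MathematicalPhysics.QuantumFieldTheory.Balaban1983to89.PBond (F.P (Summit.QuantumFields.YangMills.Theorems.K0RecordFormatNames.recordK₀ F Mc k + n)) 0) - Hd (⟨b.src.unshift ν, ν⟩ : Literature.MathematicalPhysics.QuantumFieldTheory.Balaban1983to89.PBond (F.P (Summit.QuantumFields.YangMills.Theorems.K0RecordFormatNames.recordK₀ F Mc k + n)) 0)))‖ ≤ C₉' * (F.P (Summit.QuantumFields.YangMills.Theorems.K0RecordFormatNames.recordK₀ F Mc k + n)).eta (k + 1) ^ 3 * Real.exp (-(δ₉ * ((R0 : ℝ) - (R3 : ℝ))))))) → ∀ α₂ : ℝ, 0 < α₂ → ∃ C₉ δ₀ : ℝ, 0 ≤ C₉ ∧ 0 < δ₀ ∧ ∀ k : ℕ, ∀ ε₂₉ : ℝ, 0 < ε₂₉ → (∀ a : (Summit.QuantumFields.YangMills.Theorems.K0RecordFormatNames.thetaFill F a₀ ε₂₉).ιβ, Literature.MathematicalPhysics.QuantumFieldTheory.Balaban1983to89.B12FormatPlus.Response9D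 (Summit.QuantumFields.YangMills.Theorems.K0RecordFormatNames.recordResponse9DataFromL F (Summit.QuantumFields.YangMills.Theorems.K0RecordFormatNames.thetaFill F a₀ ε₂₉) a Mc k (Summit.QuantumFields.YangMills.Theorems.K0RecordFormatNames.recordK₀ F Mc k)) (fun n => Summit.QuantumFields.YangMills.Theorems.K0RecordFormatNames.recordChartJ F Mc k (Summit.QuantumFields.YangMills.Theorems.K0RecordFormatNames.recordK₀ F Mc k + n)) (fun n => Summit.QuantumFields.YangMills.Theorems.K0RecordFormatNames.recordRNat F Mc k (Summit.QuantumFields.YangMills.Theorems.K0RecordFormatNames.recordK₀ F Mc k + n)) (fun n X => Summit.QuantumFields.YangMills.Theorems.K0RecordFormatNames.recordDom44J F Mc k (Summit.QuantumFields.YangMills.Theorems.K0RecordFormatNames.recordK₀ F Mc k + n) X α₂) C₉ δ₀) ∧ ∀ n : ℕ, letI θ := Summit.QuantumFields.YangMills.Theorems.K0RecordFormatNames.thetaFill F a₀ ε₂₉; letI := θ.instVβ₁; letI := θ.instVβ₂; ContDiffAt ℝ 2 (Summit.QuantumFields.YangMills.Theorems.K0RecordFormatNames.recordEmbJ F θ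 k (Summit.QuantumFields.YangMills.Theorems.K0RecordFormatNames.recordK₀ F Mc k + n)) 0 ∧ Summit.QuantumFields.YangMills.Theorems.K0RecordFormatNames.recordEmbJ F θ k (Summit.QuantumFields.YangMills.Theorems.K0RecordFormatNames.recordK₀ F Mc k + n) 0 = 0 := by
  intro F Mc j c c₀ c₁ B₃ B₃' a₀ a₁ hMc hc hc₀ hc₁ hB₃ hB₃' ha₀ ha₁ h8 h9 hE hreg hL α₂ hα₂
  obtain ⟨⟨CL, δL, hCL0, hδL, hLall⟩, h182, Cc, δc, hCc0, hδc, hcmpAll⟩ := hL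
  -- unified token constants
  obtain ⟨C, hCdef⟩ : ∃ C : ℝ, C = max (max CL Cc) 1 := ⟨_, rfl⟩
  obtain ⟨δ, hδdef⟩ : ∃ δ : ℝ, δ = min δL δc := ⟨_, rfl⟩
  have hC0 : 0 < C := hCdef ▸ lt_of_lt_of_le one_pos (le_max_right _ _)
  have hCL : CL ≤ C := hCdef ▸ (le_max_left _ _).trans (le_max_left _ _)
  have hCc : Cc ≤ C := hCdef ▸ (le_max_right _ _).trans (le_max_left _ _)
  have hδ0 : 0 < δ := hδdef ▸ lt_min hδL hδc
  have hδL' : δ ≤ δL := hδdef ▸ min_le_left _ _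
  have hδc' : δ ≤ δc := hδdef ▸ min_le_right _ _
  have eL : ∀ t : ℝ, 0 ≤ t → Real.exp (-(δL * t)) ≤ Real.exp (-(δ * t)) := fun t ht => Real.exp_le_exp.2 (neg_le_neg (mul_le_mul_of_nonneg_right hδL' ht))
  have ec : ∀ R3 R0 : ℕ, R3 ≤ R0 → Real.exp (-(δc * ((R0 : ℝ) - (R3 : ℝ)))) ≤ Real.exp (-(δ * ((R0 : ℝ) - (R3 : ℝ)))) := fun R3 R0 h =>
    Real.exp_le_exp.2 (neg_le_neg (mul_le_mul_of_nonneg_right hδc' (sub_nonneg.2 (Nat.cast_le.2 h))))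
  -- the (R4ᴰ) row constants
  obtain ⟨C₄, hC4def⟩ : ∃ C₄ : ℝ, C₄ = 2 * C * Real.exp (δ * (2 * Mc + 2)) *
    (2 * (2 * 1 + 2 * ‖LinearMap.toContinuousLinearMap ((Summit.QuantumFields.YangMills.Theorems.K0RecordFormatNames.sl2Proj).restrictScalars ℝ)‖ + 1) * Real.exp (4 * (δ / 8) * Mc) / α₂) := ⟨_, rfl⟩
  have hC4 : 0 ≤ C₄ := by rw [hC4def]; positivity
  obtain ⟨δ₄, hδ4def⟩ : ∃ δ₄ : ℝ, δ₄ = δ / 4 := ⟨_, rfl⟩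
  have hδ4 : 0 < δ₄ := by rw [hδ4def]; positivity
  -- ★ the global two-volume row (R4ᴰ), PROVED
  have hR4B : ∀ k : ℕ, ∀ ε₂₉ : ℝ, 0 < ε₂₉ → ∀ a : (Summit.QuantumFields.YangMills.Theorems.K0RecordFormatNames.thetaFill F a₀ ε₂₉).ιβ, (∀ (n : ℕ) (X : (Summit.QuantumFields.YangMills.Theorems.K0RecordFormatNames.recordDomSys F Mc k (Summit.QuantumFields.YangMills.Theorems.K0RecordFormatNames.recordK₀ F Mc k + n)).Dom), X ∉ Summit.QuantumFields.YangMills.Theorems.K0RecordFormatNames.recordWrapCtr F Mc k (Summit.QuantumFields.YangMills.Theorems.K0RecordFormatNames.recordK₀ F Mc k + n) → ∀ (μ : Fin 4) (z : Fin 4 → ℤ), (∀ l, 2 * |z l| < (Summit.QuantumFields.YangMills.Theorems.K0RecordFormatNames.recordRNat F Mc k (Summit.QuantumFields.YangMills.Theorems.K0RecordFormatNames.recordK₀ F Mc k + n) : ℤ)) → gauge (Summit.QuantumFields.YangMills.Theorems.K0RecordFormatNames.recordDom44J F Mc k (Summit.QuantumFields.YangMills.Theorems.K0RecordFormatNames.recordK₀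 F Mc k + n) X α₂) (Literature.MathematicalPhysics.QuantumFieldTheory.Balaban1983to89.B12FormatPlus.cutTo (Summit.QuantumFields.YangMills.Theorems.K0RecordFormatNames.recordCXJ F Mc k (Summit.QuantumFields.YangMills.Theorems.K0RecordFormatNames.recordK₀ F Mc k + n) X) fun i => Summit.QuantumFields.YangMills.Theorems.K0RecordFormatNames.recordGkL F (Summit.QuantumFields.YangMills.Theorems.K0RecordFormatNames.thetaFill F a₀ ε₂₉) k (Summit.QuantumFields.YangMills.Theorems.K0RecordFormatNames.recordK₀ F Mc k + (n + 1)) a (Summit.QuantumFields.YangMills.Theorems.K0RecordFormatNames.recordE F k (Summit.QuantumFields.YangMills.Theorems.K0RecordFormatNames.recordK₀ F Mc k + (n + 1)) μ z) (Summit.QuantumFields.YangMills.Theorems.K0RecordFormatNames.recordJXJ F (Summit.QuantumFields.YangMills.Theorems.K0RecordFormatNames.recordK₀ F Mc k + n) i) - Summit.QuantumFields.YangMills.Theorems.K0RecordFormatNames.recordGkL F (Summit.QuantumFields.YangMills.Theorems.K0RecordFormatNames.thetaFill F a₀ ε₂₉) k (Summit.QuantumFields.YangMills.Theorems.K0RecordFormatNames.recordK₀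 F Mc k + n) a (Summit.QuantumFields.YangMills.Theorems.K0RecordFormatNames.recordE F k (Summit.QuantumFields.YangMills.Theorems.K0RecordFormatNames.recordK₀ F Mc k + n) μ z) i) ≤ C₄ * Real.exp (-δ₄ * (Summit.QuantumFields.YangMills.Theorems.K0RecordFormatNames.recordRNat F Mc k (Summit.QuantumFields.YangMills.Theorems.K0RecordFormatNames.recordK₀ F Mc k + n) : ℝ) / 2) * Real.exp (-(δ₄ / 2) * (Summit.QuantumFields.YangMills.Theorems.K0RecordFormatNames.recordSiteGeom F Mc k (Summit.QuantumFields.YangMills.Theorems.K0RecordFormatNames.recordK₀ F Mc k + n)).distD (Summit.QuantumFields.YangMills.Theorems.K0RecordFormatNames.recordE F k (Summit.QuantumFields.YangMills.Theorems.K0RecordFormatNames.recordK₀ F Mc k + n) μ z) X)) := by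
    intro k ε₂₉ hε a n X hX μ z hz
    rw [hC4def, hδ4def]
    exact rowR4D_L_sandwich (F := F) a₀ ε₂₉ ha₀ hMc (Nat.le_add_right _ n) a μ z hz hX hC0 hδ0
      (fun b => fourClauses_weaken F _ b hCL hC0.le (eL _ (Nat.cast_nonneg _)) (Real.exp_pos _).le
        (hLall k n ε₂₉ hε a (Summit.QuantumFields.YangMills.Theorems.K0RecordFormatNames.recordE F k (Summit.QuantumFields.YangMills.Theorems.K0RecordFormatNames.recordK₀ F Mc k + n) μ z).1
          (Summit.QuantumFields.YangMills.Theorems.K0RecordFormatNames.recordE F k (Summit.QuantumFields.YangMills.Theorems.K0RecordFormatNames.recordK₀ F Mc k + n) μ z).2 b))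
      (fun b => fourClauses_weaken F _ b hCL hC0.le (eL _ (Nat.cast_nonneg _)) (Real.exp_pos _).le
        (hLall k (n + 1) ε₂₉ hε a (Summit.QuantumFields.YangMills.Theorems.K0RecordFormatNames.recordE F k (Summit.QuantumFields.YangMills.Theorems.K0RecordFormatNames.recordK₀ F Mc k + n + 1) μ z).1
          (Summit.QuantumFields.YangMills.Theorems.K0RecordFormatNames.recordE F k (Summit.QuantumFields.YangMills.Theorems.K0RecordFormatNames.recordK₀ F Mc k + n + 1) μ z).2 b))
      (fun b => h182 k n ε₂₉ hε a (Summit.QuantumFields.YangMills.Theorems.K0RecordFormatNames.recordE F k (Summit.QuantumFields.YangMills.Theorems.K0RecordFormatNames.recordK₀ F Mc k + n) μ z).1 (Summit.QuantumFields.YangMills.Theorems.K0RecordFormatNames.recordE F k (Summit.QuantumFields.YangMills.Theorems.K0RecordFormatNames.recordK₀ F Mc k + n) μ z).2 b)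
      (fun b => h182 k (n + 1) ε₂₉ hε a (Summit.QuantumFields.YangMills.Theorems.K0RecordFormatNames.recordE F k (Summit.QuantumFields.YangMills.Theorems.K0RecordFormatNames.recordK₀ F Mc k + n + 1) μ z).1 (Summit.QuantumFields.YangMills.Theorems.K0RecordFormatNames.recordE F k (Summit.QuantumFields.YangMills.Theorems.K0RecordFormatNames.recordK₀ F Mc k + n + 1) μ z).2 b)
      (fun R3 R0 h1 h2 z₀ hy b hb => by
        -- (the clause field `Hd` is given explicitly: higher-order inference of it is prohibitively slow here)
        have t1 := hcmpAll k n ε₂₉ hε a (Summit.QuantumFields.YangMills.Theorems.K0RecordFormatNames.recordE F k (Summit.QuantumFields.YangMills.Theorems.K0RecordFormatNames.recordK₀ F Mc k + n) μ z).1 (Summit.QuantumFields.YangMills.Theorems.K0RecordFormatNames.recordE F k (Summit.QuantumFields.YangMills.Theorems.K0RecordFormatNames.recordK₀ F Mc k + n) μ z).2 R3 R0 h1 h2 z₀ hy b hb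
        exact fourClauses_weaken F
          (fun b' : PBond (F.P (Summit.QuantumFields.YangMills.Theorems.K0RecordFormatNames.recordK₀ F Mc k + n)) 0 => Summit.QuantumFields.YangMills.Theorems.K0RecordFormatNames.recordHrLocξ F (Summit.QuantumFields.YangMills.Theorems.K0RecordFormatNames.thetaFill F a₀ ε₂₉) k (Summit.QuantumFields.YangMills.Theorems.K0RecordFormatNames.recordK₀ F Mc k + n) Finset.univ a (Summit.QuantumFields.YangMills.Theorems.K0RecordFormatNames.recordE F k (Summit.QuantumFields.YangMills.Theorems.K0RecordFormatNames.recordK₀ F Mc k + n) μ z) b' - Summit.QuantumFields.YangMills.Theorems.K0RecordFormatNames.recordHrLocξ F (Summit.QuantumFields.YangMills.Theorems.K0RecordFormatNames.thetaFill F a₀ ε₂₉) k (Summit.QuantumFields.YangMills.Theorems.K0RecordFormatNames.recordK₀ F Mc k + n) (Summit.QuantumFields.YangMills.Theorems.K0RecordFormatNames.recordWindow F k (Summit.QuantumFields.YangMills.Theorems.K0RecordFormatNames.recordK₀ F Mc k + n) R0 z₀) a (Summit.QuantumFields.YangMills.Theorems.K0RecordFormatNames.recordE F k (Summit.QuantumFields.YangMills.Theorems.K0RecordFormatNames.recordK₀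 F Mc k + n) μ z) b')
          b hCc hC0.le (ec R3 R0 (le_trans (Nat.le_add_right _ _) h1)) (Real.exp_pos _).le t1)
      (fun R3 R0 h1 h2 z₀ hy b hb => by
        have t1 := hcmpAll k (n + 1) ε₂₉ hε a (Summit.QuantumFields.YangMills.Theorems.K0RecordFormatNames.recordE F k (Summit.QuantumFields.YangMills.Theorems.K0RecordFormatNames.recordK₀ F Mc k + n + 1) μ z).1 (Summit.QuantumFields.YangMills.Theorems.K0RecordFormatNames.recordE F k (Summit.QuantumFields.YangMills.Theorems.K0RecordFormatNames.recordK₀ F Mc k + n + 1) μ z).2 R3 R0 h1 h2 z₀ hy b hb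
        exact fourClauses_weaken F
          (fun b' : PBond (F.P (Summit.QuantumFields.YangMills.Theorems.K0RecordFormatNames.recordK₀ F Mc k + n + 1)) 0 => Summit.QuantumFields.YangMills.Theorems.K0RecordFormatNames.recordHrLocξ F (Summit.QuantumFields.YangMills.Theorems.K0RecordFormatNames.thetaFill F a₀ ε₂₉) k (Summit.QuantumFields.YangMills.Theorems.K0RecordFormatNames.recordK₀ F Mc k + n + 1) Finset.univ a (Summit.QuantumFields.YangMills.Theorems.K0RecordFormatNames.recordE F k (Summit.QuantumFields.YangMills.Theorems.K0RecordFormatNames.recordK₀ F Mc k + n + 1) μ z) b' - Summit.QuantumFields.YangMills.Theorems.K0RecordFormatNames.recordHrLocξ F (Summit.QuantumFields.YangMills.Theorems.K0RecordFormatNames.thetaFill F a₀ ε₂₉) k (Summit.QuantumFields.YangMills.Theorems.K0RecordFormatNames.recordK₀ F Mc k + n + 1) (Summit.QuantumFields.YangMills.Theorems.K0RecordFormatNames.recordWindow F k (Summit.QuantumFields.YangMills.Theorems.K0RecordFormatNames.recordK₀ F Mc k + n + 1) R0 z₀) a (Summit.QuantumFields.YangMills.Theorems.K0RecordFormatNames.recordE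 F k (Summit.QuantumFields.YangMills.Theorems.K0RecordFormatNames.recordK₀ F Mc k + n + 1) μ z) b')
          b hCc hC0.le (ec R3 R0 (le_trans (Nat.le_add_right _ _) h1)) (Real.exp_pos _).le t1)
      (hreg k n ε₂₉ hε) (hreg k (n + 1) ε₂₉ hε) hα₂
  set A : ℝ := 2 * (2 * CL + 2 * ‖LinearMap.toContinuousLinearMap ((Summit.QuantumFields.YangMills.Theorems.K0RecordFormatNames.sl2Proj).restrictScalars ℝ)‖ * CL + 1) *
    Real.exp (4 * δL * Mc) / α₂ with hA
  have hA0 : 0 ≤ A := by rw [hA]; positivity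
  refine ⟨max A C₄, min δL δ₄, le_max_of_le_left hA0, lt_min hδL hδ4, fun k ε₂₉ hε => ?_⟩
  letI := (Summit.QuantumFields.YangMills.Theorems.K0RecordFormatNames.thetaFill F a₀ ε₂₉).instVβ₁
  letI := (Summit.QuantumFields.YangMills.Theorems.K0RecordFormatNames.thetaFill F a₀ ε₂₉).instVβ₂
  letI := (Summit.QuantumFields.YangMills.Theorems.K0RecordFormatNames.thetaFill F a₀ ε₂₉).instιβ
  refine ⟨fun a => ?_, fun n => ⟨?_, ?_⟩⟩
  · refine response9D_fromL_of_decayRows hMc (Summit.QuantumFields.YangMills.Theorems.K0RecordFormatNames.thetaFill F a₀ ε₂₉) a k (le_max_of_le_left hA0) (lt_min hδL hδ4).le ?_ ?_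
    · intro n X y
      obtain ⟨μ0, y0⟩ := y
      have hd2 := (hreg k n ε₂₉ hε).contDiffAt (n := 2)
      have hrow := rowR1D_L_at (F := F) hMc (Nat.le_add_right _ _) (Summit.QuantumFields.YangMills.Theorems.K0RecordFormatNames.thetaFill F a₀ ε₂₉) ha₀ hd2 a (μ0, y0) X hα₂ hCL0 hδL.le (fun b => hLall k n ε₂₉ hε a μ0 y0 b)
      refine hrow.trans ?_
      have hd0 : 0 ≤ (Summit.QuantumFields.YangMills.Theorems.K0RecordFormatNames.recordSiteGeom F Mc k (Summit.QuantumFields.YangMills.Theorems.K0RecordFormatNames.recordK₀ F Mc k + n)).distD (μ0, y0) X := (Summit.QuantumFields.YangMills.Theorems.K0RecordFormatNames.recordSiteGeom F Mc k (Summit.QuantumFields.YangMills.Theorems.K0RecordFormatNames.recordK₀ F Mc k + n)).distD_nonneg (μ0, y0) X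
      have hexp : Real.exp (-δL * (Summit.QuantumFields.YangMills.Theorems.K0RecordFormatNames.recordSiteGeom F Mc k (Summit.QuantumFields.YangMills.Theorems.K0RecordFormatNames.recordK₀ F Mc k + n)).distD (μ0, y0) X) ≤ Real.exp (-(min δL δ₄) * (Summit.QuantumFields.YangMills.Theorems.K0RecordFormatNames.recordSiteGeom F Mc k (Summit.QuantumFields.YangMills.Theorems.K0RecordFormatNames.recordK₀ F Mc k + n)).distD (μ0, y0) X) :=
        Real.exp_le_exp.2 (by nlinarith [min_le_left δL δ₄])
      calc A * Real.exp (-δL * (Summit.QuantumFields.YangMills.Theorems.K0RecordFormatNames.recordSiteGeom F Mc k (Summit.QuantumFields.YangMills.Theorems.K0RecordFormatNames.recordK₀ F Mc k + n)).distD (μ0, y0) X)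
          ≤ max A C₄ * Real.exp (-δL * (Summit.QuantumFields.YangMills.Theorems.K0RecordFormatNames.recordSiteGeom F Mc k (Summit.QuantumFields.YangMills.Theorems.K0RecordFormatNames.recordK₀ F Mc k + n)).distD (μ0, y0) X) := mul_le_mul_of_nonneg_right (le_max_left _ _) (Real.exp_pos _).le
        _ ≤ max A C₄ * Real.exp (-(min δL δ₄) * (Summit.QuantumFields.YangMills.Theorems.K0RecordFormatNames.recordSiteGeom F Mc k (Summit.QuantumFields.YangMills.Theorems.K0RecordFormatNames.recordK₀ F Mc k + n)).distD (μ0, y0) X) := mul_le_mul_of_nonneg_left hexp (hA0.trans (le_max_left _ _))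
    · intro n X hX μ z hz
      have h4 := hR4B k ε₂₉ hε a n X hX μ z hz
      refine h4.trans ?_
      have hR0 : 0 ≤ (Summit.QuantumFields.YangMills.Theorems.K0RecordFormatNames.recordRNat F Mc k (Summit.QuantumFields.YangMills.Theorems.K0RecordFormatNames.recordK₀ F Mc k + n) : ℝ) := Nat.cast_nonneg _
      have hd0 : 0 ≤ (Summit.QuantumFields.YangMills.Theorems.K0RecordFormatNames.recordSiteGeom F Mc k (Summit.QuantumFields.YangMills.Theorems.K0RecordFormatNames.recordK₀ F Mc k + n)).distD (Summit.QuantumFields.YangMills.Theorems.K0RecordFormatNames.recordE F k (Summit.QuantumFields.YangMills.Theorems.K0RecordFormatNames.recordK₀ F Mc k + n) μ z) X := (Summit.QuantumFields.YangMills.Theorems.K0RecordFormatNames.recordSiteGeom F Mc k (Summit.QuantumFields.YangMills.Theorems.K0RecordFormatNames.recordK₀ F Mc k + n)).distD_nonneg _ X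
      have hm4 : min δL δ₄ ≤ δ₄ := min_le_right _ _
      have he1 : Real.exp (-δ₄ * (Summit.QuantumFields.YangMills.Theorems.K0RecordFormatNames.recordRNat F Mc k (Summit.QuantumFields.YangMills.Theorems.K0RecordFormatNames.recordK₀ F Mc k + n) : ℝ) / 2) ≤
          Real.exp (-(min δL δ₄) * (Summit.QuantumFields.YangMills.Theorems.K0RecordFormatNames.recordRNat F Mc k (Summit.QuantumFields.YangMills.Theorems.K0RecordFormatNames.recordK₀ F Mc k + n) : ℝ) / 2) := Real.exp_le_exp.2 (by nlinarith)
      have he2 : Real.exp (-(δ₄ / 2) * (Summit.QuantumFields.YangMills.Theorems.K0RecordFormatNames.recordSiteGeom F Mc k (Summit.QuantumFields.YangMills.Theorems.K0RecordFormatNames.recordK₀ F Mc k + n)).distD (Summit.QuantumFields.YangMills.Theorems.K0RecordFormatNames.recordE F k (Summit.QuantumFields.YangMills.Theorems.K0RecordFormatNames.recordK₀ F Mc k + n) μ z) X) ≤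
          Real.exp (-(min δL δ₄ / 2) * (Summit.QuantumFields.YangMills.Theorems.K0RecordFormatNames.recordSiteGeom F Mc k (Summit.QuantumFields.YangMills.Theorems.K0RecordFormatNames.recordK₀ F Mc k + n)).distD (Summit.QuantumFields.YangMills.Theorems.K0RecordFormatNames.recordE F k (Summit.QuantumFields.YangMills.Theorems.K0RecordFormatNames.recordK₀ F Mc k + n) μ z) X) :=
        Real.exp_le_exp.2 (by nlinarith)
      exact mul_le_mul (mul_le_mul (le_max_right A C₄) he1 (Real.exp_pos _).le (hC4.trans (le_max_right A C₄))) he2 (Real.exp_pos _).le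
        (mul_nonneg (hC4.trans (le_max_right A C₄)) (Real.exp_pos _).le)
  · exact contDiffAt_recordEmbJ_of_tokP9reg F a₀ ε₂₉ ha₀ Mc k n (hreg k n ε₂₉ hε)
  · exact recordEmbJ_zero_thetaFill F a₀ ε₂₉ ha₀ Mc k n

/-- ★★★ **THE ROUTE DECLARATION `BalabanUVNodes.PortPieceLocalityU8` (item stmt-QuantumFields-27931, text v11-G₄ `bca3cb0d9af367ce`, rendered rev 36) HOLDS** — by
`portPieceLocalityU8_v13` (the route `def` unfolds to the signed text verbatim).  HONEST LABEL (director-ym №508, binding): closed AS AN IMPLICATION whose displayed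
hypothesis Tok-182 is FALSE-SHAPED (PTZ-1 memo v1 + CRIT-1 04:49:39Z) ⇒ its (C1)∕(R4ᴰ) consequent is NOT consumable by K0ᴬ; consumable residue = the ‴-only rows
(R1ᴰ)(R3)(R5)(C2) + the chain lemmas.  No K-count, no NODE-O movement. [cite: Balaban1987RG1, Thm 1 p.257, (1.21) p.264; Balaban1985Variational, (182) p.307, (190) p.308] -/
theorem portPieceLocalityU8_holds : Summit.QuantumFields.YangMills.Theses.BalabanUVNodes.PortPieceLocalityU8 := by
  unfold Summit.QuantumFields.YangMills.Theses.BalabanUVNodes.PortPieceLocalityU8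
  exact portPieceLocalityU8_v13

end Summit.QuantumFields.YangMills.Theorems.PortU8

end
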